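import Summits.ValiantsHypothesis.ValiantsHypothesis.Theorems.BarrierLeverKRSTNoGoBelow12cOnB05
import Literature.NumberTheory.GaussSums.BourgainMordellEstimate

/-!
# Route BarrierLever — item `KRSTNoGoBelow12cOnB05` (stmt-ValiantsHypothesis-19340), NAMED form:
# the band `b < 12c` from the Literature fact `BourgainMordellTwoTerm`

The hypothesis of item stmt-ValiantsHypothesis-19340 (Bourgain 2005 Thm 2 for `r ≤ 2` in
natural-number clothing, inlined in the item) is now the Literature NAMED FACT
`Literature.NumberTheory.GaussSums.BourgainMordellTwoTerm` (`BourgainMordellEstimate.lean`,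
[cite: Bourgain2005, Thm 2 (1.24) p.480 under (1.19)–(1.20) p.479]). This file restates the
conditional no-go band with the hypothesis BY NAME (the cell planner p1-g5's WANTED "new item with
the hypothesis by name"): the two spellings agree definitionally (`MordellOneTermBound` /
`MordellTwoTermBound` versus the cell's `OneTermBound` / `TwoTermBound`, `ψ = ZMod.stdAddChar`).

* `b05NatAt_of_bourgainMordellTwoTerm` — the named fact gives `B05NatAt k` for every `k`.
* `krstNoGoBelow12c_of_bourgainMordellTwoTerm` (ideal grade) and
  `krstNoGoBelow12c_perSeed_of_bourgainMordellTwoTerm` (per-seed grade): conditionally on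
  `BourgainMordellTwoTerm`, for every `c` and every `b < 12c`, KRST's generator (block `m = n^{3c}`,
  `p` the least prime `≥ m² + n + 1`) is not eventually (ideal- or per-seed-) succinct for
  `SmallCircuits ℂ n b`.

WHAT THIS IS NOT: still CONDITIONAL (the named fact is unproved in Lean; trust base = that name);
the unconditional band of record is `b < 6c` (`…Theorems/BarrierLeverKRSTNoGoBelow6c.lean`).
-/

-- layout Summits/ValiantsHypothesis/ValiantsHypothesis forces the duplicated namespace component
set_option linter.dupNamespace false

noncomputable section

namespace Summit.ValiantsHypothesis.ValiantsHypothesis.Theorems.BarrierLever.KRSTNoGoBelow12cOnB05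

open Literature.Barriers.ValiantsHypothesis Literature.Computability.AlgebraicComplexity MvPolynomial
open Summit.ValiantsHypothesis.ValiantsHypothesis.Theorems.BarrierLever.SuccinctHittingSetsForVP
open Summit.ValiantsHypothesis.ValiantsHypothesis.Theorems.BarrierLever.SuccinctHittingSetsForVP.KRSTEdge
open Literature.Computability.MetaComplexity (leastPrimeGe leastPrimeGe_spec)
open Literature.NumberTheory.GaussSums

/-- The Literature named fact `BourgainMordellTwoTerm` is, precision by precision, the cell's
hypothesis `B05NatAt k` (the predicates `MordellOneTermBound`/`MordellTwoTermBound` and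
`OneTermBound`/`TwoTermBound` agree definitionally). -/
theorem b05NatAt_of_bourgainMordellTwoTerm (hB : BourgainMordellTwoTerm) (k : ℕ) : B05NatAt k :=
  fun hk => hB k hk

/-- **The band `b < 12c`, ideal grade, from the named fact**: conditionally on Bourgain 2005 Thm 2
(`BourgainMordellTwoTerm`), for every `c` and every `b < 12c`, KRST's generator is not eventually
ideal-succinct for `SmallCircuits ℂ n b`. [cite: Bourgain2005, Thm 2] -/
theorem krstNoGoBelow12c_of_bourgainMordellTwoTerm (hB : BourgainMordellTwoTerm) :
    ∀ c b : ℕ, b < 12 * c → ¬ (∃ n₀ : ℕ, ∀ n ≥ n₀,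
      IsIdealSuccinctGenerator (degLEMonomials n) (SmallCircuits ℂ n b)
        (@krstGen ℂ _ (leastPrimeGe (n ^ (3 * c) * n ^ (3 * c) + n + 1)) n
          ⟨(leastPrimeGe_spec (n ^ (3 * c) * n ^ (3 * c) + n + 1)).2⟩ (n ^ (3 * c))
          (le_trans (Nat.le_add_right (n ^ (3 * c) * n ^ (3 * c)) (n + 1))
            (leastPrimeGe_spec (n ^ (3 * c) * n ^ (3 * c) + n + 1)).1))) :=
  krstNoGoBelow12c_of_B05 (b05NatAt_of_bourgainMordellTwoTerm hB)

/-- **The band `b < 12c`, per-seed grade, from the named fact.** [cite: Bourgain2005, Thm 2] -/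
theorem krstNoGoBelow12c_perSeed_of_bourgainMordellTwoTerm (hB : BourgainMordellTwoTerm) :
    ∀ c b : ℕ, b < 12 * c → ¬ (∃ n₀ : ℕ, ∀ n ≥ n₀,
      IsSuccinctGenerator (degLEMonomials n) (SmallCircuits ℂ n b)
        (@krstGen ℂ _ (leastPrimeGe (n ^ (3 * c) * n ^ (3 * c) + n + 1)) n
          ⟨(leastPrimeGe_spec (n ^ (3 * c) * n ^ (3 * c) + n + 1)).2⟩ (n ^ (3 * c))
          (le_trans (Nat.le_add_right (n ^ (3 * c) * n ^ (3 * c)) (n + 1))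
            (leastPrimeGe_spec (n ^ (3 * c) * n ^ (3 * c) + n + 1)).1))) :=
  krstNoGoBelow12c_perSeed_of_B05 (b05NatAt_of_bourgainMordellTwoTerm hB)

end Summit.ValiantsHypothesis.ValiantsHypothesis.Theorems.BarrierLever.KRSTNoGoBelow12cOnB05

end
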